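import Mathlib
import Literature.Analysis.FluidPDE.Tao2016AveragedNS.ShiftSetCascadeFlows
import Literature.Analysis.FluidPDE.Tao2016AveragedNS.ShiftSetCascadeFlux
import Summits.NavierStokesRegularity.NavierStokesRegularity.Theorems.TaoLadderRungTwoFlatCertificateGlueCertificateFinalOn
import Summits.NavierStokesRegularity.NavierStokesRegularity.Theorems.TaoLadderRungTwoFlatCertificateGlueCheckerLandPOn
import HarnessLib

/-!
# Certificate glue on a shift set `𝕊`, XXXVI-c: THE FINAL ASSEMBLY WITH A BOX-FAMILY CORE, PER-BRANCH GAUGES AND READOUT-L — glue IX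
  `stub_rung_quarter_of_checks` with `htrap` := glue XXXV-c `htrap_of_chainChecksP`, `hland` := glue XXXV-c `hland_of_chainChecksL`, the core
  `Z := coreBoxFam Cs cen chw` (the datum's box and the fat successor boxes `Cs_l·[cen_l ∓ chw_l]` of theory-1's E3 v0 architecture), and `hcore` /
  `hdatum` / `hcoreTop` / `hinside` / `hcover` from ONE Boolean `checkRefBox` per box and `checkDatumBox` (helper for item stmt-NavierStokesRegularity-22987
  `FlatGapCertificatesV2` (crux K_A♭ of route TaoLadderRungTwoFlat); cell harvest/h2-tao-ladder, p1 g17; theory-1 g29 A-77 §4 / F-40 / F-44 and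
  INSTANCE-MANIFEST v1; referee c73 ruling P158: «an instance needs A-77 (checkReadoutL + read_of_checkReadoutL PROVED + box-family core with
  hcoreTop/hinside/hcover Booleans) and per-branch indexing of ωq qz Sp Sm bD cB inside ∀ bb» — this file is exactly that format)

REMAINING INPUTS of `stub_rung_quarter_of_certificateL`: the data; the Booleans (`checkCoefTab`-type `CoefBoxOK` per branch, `checkGlobalG` per branch,
`checkStepG` per step, `checkTransit`, `checkSection`, `checkReadoutL`, `checkSecBelow/Above`, `checkIdFrame`, `checkNonneg`, `checkRefBox` per box,
`checkDatumBox`); glue IX's real scalar checks `A₁–A₆`, `B₁–B₂`, `hMZf`, `hMν`; and the envelope INEQUALITIES `Zf(−Kb−1) ≤ Eb`, `ν(Ka+1)r/w_Ka ≤ Et`,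
`Zx ≤ Zb(−Kb−1)` (rational outer bounds — the glue-IX envelopes are irrational for `γ = ½`, so the equalities of glue XXXVI/XXXVI-b could not be instantiated;
the three clauses are monotone in the right direction).

HONEST FRAMING: Tao-type MODEL lattice `T♭(½)` on `S♭` at `ε₀ = ¼`; soundness of the certificate FORMAT — NO certificate instance exists in the tree,
nothing is certified here, no stub is closed by this file, nothing here is a statement about the Navier–Stokes equations.
-/

noncomputable section

-- the sub-problem namespace repeats the summit name by design (D-0017)
set_option linter.dupNamespace false

namespace Summit.NavierStokesRegularity.NavierStokesRegularity.Theorems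

open Set Finset Literature.Analysis.FluidPDE Literature.Analysis.FluidPDE.TaoCascade
open Summit.NavierStokesRegularity.NavierStokesRegularity.Theorems.TaylorModelCert

namespace CertificateGlueOn

variable {Kb Ka : ℤ}

/-! ### The fat core family and its per-box tests -/

/-- **The fat core family**: states lying, ON THE WINDOW, in one of finitely many boxes `Cs_l·[cen_l ∓ chw_l]` (STATE units; nothing is asked off the
window, so the family is window-determined as glue IX requires). [folklore] -/
def coreBoxFam (Kb Ka : ℤ) {L : ℕ} (Cs : Fin L → ℚ) (cen chw : Fin L → Array Dyad) : (Fin 2 → ℤ → ℝ) → Prop := fun z =>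
  ∃ l : Fin L, ∀ (i : Fin 2) (k : ℤ) (h : -Kb ≤ k ∧ k ≤ Ka),
    |z i k - (Cs l : ℝ) * (dgetD (cen l) (idxOf Kb Ka i k h)).toReal| ≤ (Cs l : ℝ) * (dgetD (chw l) (idxOf Kb Ka i k h)).toReal

/-- **The per-box test** (theory-1 A-77 §4): `0 ≤ Cs`; on the window, `0 < w_k`, `0 ≤ chw_d`, the interior clause `Cs(|cen_d| + chw_d) + r/w_k < M_k`,
the cover of the fattened box by the weighted start box `(x0, r0)` of the assigned branch (that branch's weights `ωq`):
`|Cs cen_d/ω − x0_d| + (Cs chw_d + r/w_k)/ω ≤ r0_d`, and the top clause `4 w_Ka Cs (|cen_d| + chw_d) ≤ r` at `k = Ka`. [folklore] -/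
def checkRefBox (Kb Ka : ℤ) (ωq : Fin 2 → ℤ → ℚ) (wq Mq : ℤ → ℚ) (r Cs : ℚ) (cen chw x0 r0 : Array Dyad) : Bool :=
  let W := winLen Kb Ka
  decide (0 ≤ Cs) &&
  (List.finRange 2).all fun i => (List.range W).all fun cc =>
    let k : ℤ := (cc : ℤ) - Kb
    let d := cc + W * i.val
    let c := dyadToRat (dgetD cen d)
    let hh := dyadToRat (dgetD chw d)
    decide (0 < wq k) && decide (0 ≤ hh) && decide (Cs * (|c| + hh) + r / wq k < Mq k) &&
    decide (|Cs * c / ωq i k - dyadToRat (dgetD x0 d)| + (Cs * hh + r / wq k) / ωq i k ≤ dyadToRat (dgetD r0 d)) &&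
    (decide (k ≠ Ka) || decide (4 * (wq Ka * (Cs * (|c| + hh))) ≤ r))

/-- **The datum test**: the window table of `datumState 0 X₀`, `X₀ = x0q`, lies in the box `Cs·[cen ∓ chw]`. [folklore] -/
def checkDatumBox (Kb Ka : ℤ) (x0q : Fin 2 → ℚ) (Cs : ℚ) (cen chw : Array Dyad) : Bool :=
  (List.finRange 2).all fun i => (List.range (winLen Kb Ka)).all fun cc =>
    decide (|(if ((cc : ℤ) - Kb) = 0 then x0q i else 0) / |x0q 0| - Cs * dyadToRat (dgetD cen (cc + winLen Kb Ka * i.val))| ≤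
      Cs * dyadToRat (dgetD chw (cc + winLen Kb Ka * i.val)))

/-- Unpacking `checkRefBox` at a window pair. [folklore] -/
theorem checkRefBox_at {ωq : Fin 2 → ℤ → ℚ} {wq Mq : ℤ → ℚ} {r Cs : ℚ} {cen chw x0 r0 : Array Dyad}
    (h : checkRefBox Kb Ka ωq wq Mq r Cs cen chw x0 r0 = true) (i : Fin 2) {k : ℤ} (hw : -Kb ≤ k ∧ k ≤ Ka) :
    0 ≤ Cs ∧ 0 < wq k ∧ 0 ≤ dyadToRat (dgetD chw (idxOf Kb Ka i k hw)) ∧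
      Cs * (|dyadToRat (dgetD cen (idxOf Kb Ka i k hw))| + dyadToRat (dgetD chw (idxOf Kb Ka i k hw))) + r / wq k < Mq k ∧
      |Cs * dyadToRat (dgetD cen (idxOf Kb Ka i k hw)) / ωq i k - dyadToRat (dgetD x0 (idxOf Kb Ka i k hw))| +
          (Cs * dyadToRat (dgetD chw (idxOf Kb Ka i k hw)) + r / wq k) / ωq i k ≤ dyadToRat (dgetD r0 (idxOf Kb Ka i k hw)) ∧
      (k = Ka → 4 * (wq Ka * (Cs * (|dyadToRat (dgetD cen (idxOf Kb Ka i k hw))| + dyadToRat (dgetD chw (idxOf Kb Ka i k hw))))) ≤ r) := by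
  simp only [checkRefBox, List.all_eq_true, List.mem_finRange, List.mem_range, Bool.and_eq_true, Bool.or_eq_true, decide_eq_true_eq,
    true_implies] at h
  obtain ⟨hCs, h⟩ := h
  have hcc : (k + Kb).toNat < winLen Kb Ka := by unfold winLen; rw [Int.toNat_lt_toNat (by omega)]; omega
  obtain ⟨⟨⟨⟨h1, h2⟩, h3⟩, h4⟩, h5⟩ := h i (k + Kb).toNat hcc
  rw [Int.toNat_of_nonneg (by omega), show k + Kb - Kb = k by ring] at h1 h3 h4 h5
  rw [idxOf_val i hw]
  refine ⟨hCs, h1, h2, h3, h4, fun hk => ?_⟩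
  rcases h5 with h5 | h5
  · exact absurd hk h5
  · exact h5

/-- The three consequences of `checkRefBox` for a state `z` of the box and a state `S₀` in the weighted `r`-ball of `z`: the interior clause, the cover by
the start box, and the top clause for `z`. [folklore] -/
theorem refBox_consequences {ωq : Fin 2 → ℤ → ℚ} (hω : ∀ i k, 0 < ωq i k) {wq Mq : ℤ → ℚ} {r Cs : ℚ} {cen chw x0 r0 : Array Dyad}
    (hKb : 0 ≤ Kb) (hKa : 1 ≤ Ka) (h : checkRefBox Kb Ka ωq wq Mq r Cs cen chw x0 r0 = true) {z S₀ : Fin 2 → ℤ → ℝ}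
    (hz : ∀ (i : Fin 2) (k : ℤ) (hw : -Kb ≤ k ∧ k ≤ Ka),
      |z i k - (Cs : ℝ) * (dgetD cen (idxOf Kb Ka i k hw)).toReal| ≤ (Cs : ℝ) * (dgetD chw (idxOf Kb Ka i k hw)).toReal)
    (hS : ∀ i k, -Kb ≤ k → k ≤ Ka → (wq k : ℝ) * |S₀ i k - z i k| ≤ (r : ℝ)) :
    (∀ i k, -Kb ≤ k → k ≤ Ka → |S₀ i k| < (Mq k : ℝ)) ∧
      (∀ d, |pxcoord Kb Ka (fun i k => (ωq i k : ℝ)) S₀ d - dvec (n := 2 * winLen Kb Ka) x0 d| ≤ dvec (n := 2 * winLen Kb Ka) r0 d) ∧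
      (∀ i, 4 * ((wq Ka : ℝ) * |z i Ka|) ≤ (r : ℝ)) := by
  have hKK : 0 ≤ Ka + Kb + 1 := by omega
  have key : ∀ (i : Fin 2) (k : ℤ) (hw : -Kb ≤ k ∧ k ≤ Ka),
      |S₀ i k| < (Mq k : ℝ) ∧
      |pxcoord Kb Ka (fun i k => (ωq i k : ℝ)) S₀ (idxOf Kb Ka i k hw) - dvec (n := 2 * winLen Kb Ka) x0 (idxOf Kb Ka i k hw)| ≤
        dvec (n := 2 * winLen Kb Ka) r0 (idxOf Kb Ka i k hw) ∧
      (k = Ka → 4 * ((wq Ka : ℝ) * |z i k|) ≤ (r : ℝ)) := by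
    intro i k hw
    obtain ⟨hCs, h1, h2, h3, h4, h5⟩ := checkRefBox_at h i hw
    have hwk : (0 : ℝ) < (wq k : ℝ) := by exact_mod_cast h1
    have hωk : (0 : ℝ) < (ωq i k : ℝ) := by exact_mod_cast hω i k
    have hCsR : (0 : ℝ) ≤ (Cs : ℝ) := by exact_mod_cast hCs
    set c : ℝ := (dgetD cen (idxOf Kb Ka i k hw)).toReal
    set hh : ℝ := (dgetD chw (idxOf Kb Ka i k hw)).toReal
    have hzb := hz i k hw
    have hd : |S₀ i k - z i k| ≤ (r : ℝ) / (wq k : ℝ) := by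
      rw [le_div_iff₀ hwk, mul_comm]; exact hS i k hw.1 hw.2
    -- `|z| ≤ Cs (|c| + hh)` and `|S₀ − Cs c| ≤ Cs hh + r/w`
    have hzabs : |z i k| ≤ (Cs : ℝ) * (|c| + hh) := by
      have := abs_add_le (z i k - (Cs : ℝ) * c) ((Cs : ℝ) * c); rw [sub_add_cancel] at this
      rw [abs_mul, abs_of_nonneg hCsR] at this; nlinarith
    have hSc : |S₀ i k - (Cs : ℝ) * c| ≤ (Cs : ℝ) * hh + (r : ℝ) / (wq k : ℝ) := by
      have := abs_add_le (S₀ i k - z i k) (z i k - (Cs : ℝ) * c); rw [show S₀ i k - z i k + (z i k - (Cs : ℝ) * c) = S₀ i k - (Cs : ℝ) * c by ring] at this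
      linarith
    have h3r := (Rat.cast_lt (K := ℝ)).mpr h3
    have h4r := (Rat.cast_le (K := ℝ)).mpr h4
    simp only [Rat.cast_add, Rat.cast_abs, Rat.cast_div, Rat.cast_sub, Rat.cast_mul, cast_dyadToRat] at h3r h4r
    refine ⟨?_, ?_, fun hk => ?_⟩
    · have : |S₀ i k| ≤ (Cs : ℝ) * (|c| + hh) + (r : ℝ) / (wq k : ℝ) := by
        have := abs_add_le (S₀ i k - (Cs : ℝ) * c) ((Cs : ℝ) * c); rw [sub_add_cancel] at this
        rw [abs_mul, abs_of_nonneg hCsR] at this; nlinarith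
      exact this.trans_lt h3r
    · rw [pxcoord_idxOf S₀ i hw]
      simp only [dvec]
      have e : S₀ i k / (ωq i k : ℝ) - (dgetD x0 (idxOf Kb Ka i k hw)).toReal =
          ((Cs : ℝ) * c / (ωq i k : ℝ) - (dgetD x0 (idxOf Kb Ka i k hw)).toReal) + (S₀ i k - (Cs : ℝ) * c) / (ωq i k : ℝ) := by ring
      rw [e]
      refine (abs_add_le _ _).trans (le_trans (add_le_add le_rfl ?_) h4r)
      rw [abs_div, abs_of_pos hωk]
      exact div_le_div_of_nonneg_right hSc hωk.le
    · have h5r := (Rat.cast_le (K := ℝ)).mpr (h5 hk)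
      simp only [Rat.cast_mul, Rat.cast_ofNat, Rat.cast_add, Rat.cast_abs, cast_dyadToRat] at h5r
      have hwK : (0 : ℝ) ≤ (wq Ka : ℝ) := by rw [← hk]; exact hwk.le
      nlinarith [mul_le_mul_of_nonneg_left hzabs hwK]
  refine ⟨fun i k hk1 hk2 => (key i k ⟨hk1, hk2⟩).1, fun d => ?_, fun i => (key i Ka ⟨by omega, le_rfl⟩).2.2 rfl⟩
  obtain ⟨hk1, hk2⟩ := shellAt_mem hKK (finProdFinEquiv.symm d).2
  have hw : -Kb ≤ shellAt Kb (finProdFinEquiv.symm d).2 ∧ shellAt Kb (finProdFinEquiv.symm d).2 ≤ Ka := ⟨hk1, hk2⟩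
  have hd : idxOf Kb Ka (finProdFinEquiv.symm d).1 (shellAt Kb (finProdFinEquiv.symm d).2) hw = d := by
    apply Fin.ext
    rw [idxOf_val _ hw, ← val_eq_of_symm d]
  have := (key (finProdFinEquiv.symm d).1 _ hw).2.1
  rwa [hd] at this

/-! ### The final assembly -/

/-- **THE REGISTERED STUB `stub_rung_quarter` FROM A CHECKED CERTIFICATE WITH PER-BRANCH GAUGES, READOUT-L AND A BOX-FAMILY CORE**: glue IX
`stub_rung_quarter_of_checks` with `htrap` := glue XXXV-c `htrap_of_chainChecksP`, `hland` := glue XXXV-c `hland_of_chainChecksL` (readout by `checkReadoutL`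
against the box of the assigned reference index `tgt bb j`), the core `Z := coreBoxFam Cs cen chw`, and `hcore` / `hdatum` / `hcoreTop` / `hinside` / `hcover`
from `checkRefBox` (box `l` covered by the start box of branch `start l`, in that branch's gauge) / `checkDatumBox`.
[cite: Tao2016AveragedNS, §6.3–6.4 Props. 6.4–6.5 (statement shape of a renormalisation certificate); route TaoLadderRungTwoFlat, crux K_A♭, stub_rung_quarter, certificate format L] -/
theorem stub_rung_quarter_of_certificateL
    -- window, datum
    {Kb Ka : ℤ} (hKb : 0 ≤ Kb) (hKa : 4 ≤ Ka) {x0q : Fin 2 → ℚ} (hx0 : x0q 0 ≠ 0)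
    -- glue IX's reals, tied to rationals
    {M w : ℤ → ℝ} {Mq wq : ℤ → ℚ} (hM : ∀ k, M k = (Mq k : ℝ)) (hwq : ∀ k, w k = (wq k : ℝ))
    {r ρ θ₀ θ c₀ c σ : ℝ} {rq ρq c₀q cq σq : ℚ} {θn θd : ℕ} (hrq : r = (rq : ℝ)) (hρq : ρ = (ρq : ℝ))
    (hθ₀q : θ₀ = (θn : ℝ) / (θd : ℝ)) (hc₀q : c₀ = (c₀q : ℝ)) (hcq : c = (cq : ℝ)) (hσq : σ = (σq : ℝ))
    (hr : 0 < r) (hρ : 0 ≤ ρ) (hρ1 : ρ < 1) (hθ₀ : 0 ≤ θ₀) (hθ₀θ : θ₀ < θ) (hθ : θ ≤ 1 / 2) (hc₀ : 0 < c₀) (hc₀c : c₀ < c) (hσ : 0 < σ)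
    {Mmax : ℝ} (hMmax : ∀ k, -Kb ≤ k → k ≤ Ka → M k ≤ Mmax)
    -- the piecewise-Gaussian weight
    {Cw b : ℝ} (hCw : 1 ≤ Cw) (hb : 1 / 2 ≤ b)
    (hwp : ∀ k : ℤ, 0 ≤ k → w k = Cw * (2 : ℝ) ^ ((k : ℝ) ^ 2 / 2 + b * k)) (hwn : ∀ k : ℤ, k < 0 → w k = Cw)
    -- wake side
    {Zb Zf : ℤ → ℝ} {Cb γ : ℝ} (hCb : 0 < Cb) (hγ0 : 0 ≤ γ) (hγ1 : γ ≤ 1)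
    (hZb : ∀ j : ℤ, Zb j = Cb * (1 + (1 / 4 : ℝ)) ^ (-(γ * j)))
    (hZf : ∀ j : ℤ, Zf j = 2 * (Zb j + r / Cw)) (hMZf : M (-Kb) ≤ Zf (-Kb))
    (checkB₁ : 32 * c * 28 * (1 + (1 / 4 : ℝ)) ^ (2 * γ) *
      ((1 + (1 / 4 : ℝ)) ^ ((5 : ℝ) * ((-Kb - 1 : ℤ) : ℝ) / 2) * (Zb (-Kb - 1) + r / Cw)) ≤ 1)
    (checkB₂ : (1 + (1 / 4 : ℝ)) ^ θ₀ * (Zb (-Kb - 1) + r / Cw +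
      32 * c * 28 * (1 + (1 / 4 : ℝ)) ^ (2 * γ) *
        ((1 + (1 / 4 : ℝ)) ^ ((5 : ℝ) * ((-Kb - 1 : ℤ) : ℝ) / 2) * (Zb (-Kb - 1) + r / Cw) ^ 2)) ≤ Zb (-Kb - 1 - 1))
    -- quiet side
    {ν : ℤ → ℝ} {ν₀ ν₁ ϑ : ℝ}
    (hνKa : ν Ka = ν₀) (hνhi : ∀ K : ℤ, Ka + 1 ≤ K → ν K = ν₁) (hν₀ : 0 ≤ ν₀) (hν₁ : 0 ≤ ν₁)
    (hMν : M Ka ≤ ν₀ * r / w (Ka - 1))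
    (checkA₁ : (1 + (1 / 4 : ℝ)) ^ ((5 : ℝ) * ((Ka + 1 : ℤ) : ℝ) / 2) * r * w (Ka + 1 - 1) ≤ ϑ * w (Ka + 1 - 2) ^ 2)
    (checkA₂ : (1 + (1 / 4 : ℝ)) ^ ((5 : ℝ) * ((Ka : ℤ) : ℝ) / 2) *
      coeffAbsOn (botShifts shiftSetFlat) (mirrorTable (1 / 2) (1 / 2)) * c * (ν₀ * r / w (Ka - 1)) ≤ 1 / 2)
    (checkA₃ : (1 + (1 / 4 : ℝ)) ^ ((5 : ℝ) * ((Ka + 1 : ℤ) : ℝ) / 2) *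
      coeffAbsOn (botShifts shiftSetFlat) (mirrorTable (1 / 2) (1 / 2)) * c * (ν₁ * r / w Ka) ≤ 1 / 2)
    (checkA₄ : 2 * (Real.sqrt 2 * Real.sqrt (4 / 3 * (2 : ℕ) * (25 / 32)) / (2 * (1 + (1 / 4 : ℝ)) ^ ((Ka : ℤ) : ℝ)) +
      coeffAbsOn (botShifts shiftSetFlat) (mirrorTable (1 / 2) (1 / 2)) * c *
        (ϑ / (1 + (1 / 4 : ℝ)) ^ ((5 : ℝ) / 2)) * ν₀ ^ 2) ≤ ν₁)
    (checkA₅ : 2 * (Real.sqrt 2 * Real.sqrt (4 / 3 * (2 : ℕ) * (25 / 32)) / (2 * (1 + (1 / 4 : ℝ)) ^ ((Ka + 1 : ℤ) : ℝ)) +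
      coeffAbsOn (botShifts shiftSetFlat) (mirrorTable (1 / 2) (1 / 2)) * c *
        (ϑ / (1 + (1 / 4 : ℝ)) ^ ((5 : ℝ) / 2)) * ν₁ ^ 2) ≤ ν₁)
    (checkA₆ : ν₁ * (1 + (1 / 4 : ℝ)) ^ θ₀ ≤ ρ)
    -- the envelope values used by the checkers: rational OUTER bounds of the (irrational) envelopes (`Zf(−Kb−1) = 2(Cb(5/4)^{γ(Kb+1)} + r/Cw)`)
    {Eb Et Zx : ℚ} (hEb : Zf (-Kb - 1) ≤ (Eb : ℝ)) (hEt : ν (Ka + 1) * r / w Ka ≤ (Et : ℝ)) (hZx : (Zx : ℝ) ≤ Zb (-Kb - 1))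
    -- THE CERTIFICATE: per-branch gauges and tables, branch chains, section records, READOUT-L data, the box family
    {ι : Type*} {ωq : ι → Fin 2 → ℤ → ℚ} (hω : ∀ bb i k, 0 < ωq bb i k)
    {cB : ι → Fin 2 → ℤ → Fin 2 → Fin 2 → ℤ × ℤ × ℤ → IntervalD}
    (hcoef : ∀ bb, CoefBoxOK shiftsFlat (((1 / 4 : ℚ)) : ℝ) (fun i₁ i₂ i μ => ((mirrorTableQ (1 / 2) (1 / 2) i₁ i₂ i μ : ℚ) : ℝ)) Kb Ka
      (fun i k => (ωq bb i k : ℝ)) (cB bb))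
    {prec p : ι → ℕ} {kexp nexp : ℕ} {Sp Sm : ι → IntervalD} {bD : ι → Dyad} {qz : ι → Array ℤ} {lev : ι → ℚ}
    {rec : ι → ℕ → VRec} {N j₁ j₂ : ι → ℕ} {sr : ι → ℕ → SecRec} {ell : ι → ℕ → Array Dyad}
    {L : ℕ} {Cs : Fin L → ℚ} {cen chw : Fin L → Array Dyad} {start : Fin L → ι} {tgt : ι → ℕ → Fin L} {l₀ : Fin L}
    (hg : ∀ bb, checkGlobalG 2 Kb Ka (prec bb) shiftsFlat (cB bb) (1 / 4) (Sp bb) (Sm bb) (bD bb) = true)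
    (hs : ∀ bb j, j < N bb →
      checkStepG 2 Kb Ka (prec bb) (p bb) kexp nexp shiftsFlat (cB bb) (mirrorTableQ (1 / 2) (1 / 2)) (ωq bb) (Sp bb) (Sm bb) (bD bb) Eb Et (rec bb) j = true)
    (htr : ∀ bb j, j < N bb → checkTransit 2 Kb Ka (ωq bb) Mq (rec bb j).lo (rec bb j).hi = true)
    (hcN : ∀ bb, cq ≤ sumHV (rec bb) (N bb))
    (hj : ∀ bb, j₁ bb ≤ j₂ bb) (hjN : ∀ bb, j₂ bb < N bb)
    (hsec : ∀ bb j, j₁ bb ≤ j → j ≤ j₂ bb →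
      checkSection 2 Kb Ka (prec bb) shiftsFlat (cB bb) (qz bb) (rec bb j).lo (rec bb j).hi (rec bb j).δ (sr bb j) = true)
    (hread : ∀ bb j, j₁ bb ≤ j → j ≤ j₂ bb →
      checkReadoutL 2 Kb Ka (ωq bb) 0 (1 / 4) σq ρq rq Zx Et θn θd wq (Cs (tgt bb j)) (ell bb j) (cen (tgt bb j)) (chw (tgt bb j))
        (xsArr (2 * winLen Kb Ka) (qz bb) (sr bb j) (rec bb j).x (lev bb)) (csArr (2 * winLen Kb Ka) (qz bb) (sr bb j) (rec bb j).C) (rec bb j).r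
        (esArr (2 * winLen Kb Ka) (qz bb) (sr bb j) (rec bb j).E (rec bb j).h) = true)
    (hbefore : ∀ bb, checkSecBelow (2 * winLen Kb Ka) (qz bb) (rec bb (j₁ bb)) (lev bb) = true)
    (hafter : ∀ bb, checkSecAbove (2 * winLen Kb Ka) (qz bb) (rec bb (j₂ bb + 1)) (lev bb) = true)
    (hpos : ∀ bb, 0 < sumHV (rec bb) (j₁ bb)) (hc₀N : ∀ bb, sumHV (rec bb) (j₂ bb + 1) ≤ c₀q)
    (hid : ∀ bb, checkIdFrame (2 * winLen Kb Ka) (rec bb 0).C = true) (hE : ∀ bb, checkNonneg (2 * winLen Kb Ka) (rec bb 0).E = true)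
    (hrefs : ∀ l, checkRefBox Kb Ka (ωq (start l)) wq Mq rq (Cs l) (cen l) (chw l) (rec (start l) 0).x (rec (start l) 0).r = true)
    (hdat : checkDatumBox Kb Ka x0q (Cs l₀) (cen l₀) (chw l₀) = true) :
    ∃ (σ : ℝ) (X₀ : Fin 2 → ℝ) (Z : Set (Fin 2 → ℤ → ℝ)) (w : ℤ → ℝ) (r ρ θ₀ θ c₀ c : ℝ) (env₀ : ℤ → ℝ),
      X₀ 0 ≠ 0 ∧
        GapData₂On shiftSetFlat σ (1 / 4) (0 : Fin 2) (mirrorTable (1 / 2) (1 / 2)) X₀ Z w r ρ θ₀ θ c₀ c env₀ ∧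
          TailThin (1 / 4) w r ∧
            ∃ (Cw b : ℝ), 1 ≤ Cw ∧ 1 / 2 ≤ b ∧ ∀ k : ℤ, 0 ≤ k → w k = Cw * (2 : ℝ) ^ ((k : ℝ) ^ 2 / 2 + b * k) := by
  -- tie the reals to the rationals
  have hMfun : M = fun k => (Mq k : ℝ) := funext hM
  have hwfun : w = fun k => (wq k : ℝ) := funext hwq
  subst hMfun hwfun hrq hρq hθ₀q hc₀q hcq hσq
  have hKa1 : 1 ≤ Ka := by omega
  have hq : (0 : ℝ) < 1 + ((1 / 4 : ℚ) : ℝ) := by push_cast; norm_num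
  have hqe : ((1 / 4 : ℚ) : ℝ) = (1 / 4 : ℝ) := by push_cast; ring
  have h𝕊 : IsNearestNeighbourSet shiftsFlat.toFinset := by rw [shiftsFlat_toFinset]; exact isNearestNeighbourSet_shiftSetFlat
  -- the datum and the core
  set X₀ : Fin 2 → ℝ := fun i => (x0q i : ℝ) with hX₀def
  have hX₀ : X₀ 0 ≠ 0 := by simp only [hX₀def]; exact_mod_cast hx0
  set Core : (Fin 2 → ℤ → ℝ) → Prop := coreBoxFam Kb Ka Cs cen chw with hCore
  have hcore : ∀ z z' : Fin 2 → ℤ → ℝ, (∀ i k, -Kb ≤ k → k ≤ Ka → z i k = z' i k) → Core z → Core z' := by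
    intro z z' hzz' ⟨l, hl⟩
    exact ⟨l, fun i k hw => (hzz' i k hw.1 hw.2) ▸ hl i k hw⟩
  have hdatum : Core (datumState (0 : Fin 2) X₀) := by
    refine ⟨l₀, fun i k hw => ?_⟩
    simp only [checkDatumBox, List.all_eq_true, List.mem_finRange, List.mem_range, decide_eq_true_eq, true_implies] at hdat
    have hcc : (k + Kb).toNat < winLen Kb Ka := by unfold winLen; rw [Int.toNat_lt_toNat (by omega)]; omega
    have h1 := hdat i (k + Kb).toNat hcc
    rw [Int.toNat_of_nonneg (by omega), show k + Kb - Kb = k by ring] at h1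
    have h1r := (Rat.cast_le (K := ℝ)).mpr h1
    simp only [Rat.cast_abs, Rat.cast_sub, Rat.cast_div, Rat.cast_mul, cast_dyadToRat] at h1r
    rw [idxOf_val i hw]
    simp only [datumState, hX₀def]
    rcases eq_or_ne k 0 with hk0 | hk0
    · simp only [hk0, if_true] at h1r ⊢; exact h1r
    · simp only [if_neg hk0] at h1r ⊢; push_cast at h1r; exact h1r
  have hcoreL : ∀ (l : Fin L) (z : Fin 2 → ℤ → ℝ), InCoreBox Kb Ka (Cs l) (cen l) (chw l) z → Core z :=
    fun l z hz => ⟨l, fun i k hw => hz.2 i k hw⟩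
  have hcoreTop : ∀ z, Core z → ∀ i, 4 * ((wq Ka : ℝ) * |z i Ka|) ≤ (rq : ℝ) := by
    intro z ⟨l, hl⟩ i
    have hS : ∀ i k, -Kb ≤ k → k ≤ Ka → (wq k : ℝ) * |z i k - z i k| ≤ (rq : ℝ) := fun i k _ _ => by
      rw [sub_self, abs_zero, mul_zero]; exact_mod_cast hr.le
    exact (refBox_consequences (hω (start l)) hKb hKa1 (hrefs l) hl hS).2.2 i
  have hinside : ∀ (z S₀ : Fin 2 → ℤ → ℝ), Core z →
      (∀ i k, -Kb ≤ k → k ≤ Ka → (wq k : ℝ) * |S₀ i k - z i k| ≤ (rq : ℝ)) → ∀ i k, -Kb ≤ k → k ≤ Ka → |S₀ i k| < (Mq k : ℝ) :=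
    fun z S₀ ⟨l, hl⟩ hS => (refBox_consequences (hω (start l)) hKb hKa1 (hrefs l) hl hS).1
  have hcover : ∀ (z S₀ : Fin 2 → ℤ → ℝ), Core z → (∀ i k, -Kb ≤ k → k ≤ Ka → (wq k : ℝ) * |S₀ i k - z i k| ≤ (rq : ℝ)) →
      ∃ bb, ∀ d, |pxcoord Kb Ka (fun i k => (ωq bb i k : ℝ)) S₀ d - dvec (n := 2 * winLen Kb Ka) (rec bb 0).x d| ≤
        dvec (n := 2 * winLen Kb Ka) (rec bb 0).r d :=
    fun z S₀ ⟨l, hl⟩ hS => ⟨start l, (refBox_consequences (hω (start l)) hKb hKa1 (hrefs l) hl hS).2.1⟩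
  -- the two dynamic clauses from the chain checkers
  have htrap0 := htrap_of_chainChecksP (Core := Core) (w := fun k => (wq k : ℝ)) (r := (rq : ℝ)) hKb hKa1 shiftsFlat_nodup h𝕊 hω hcoef
    (c := cq) (Mq := Mq) hg hs htr hcN hid hE hcover
  have hland0 := hland_of_chainChecksL (Core := Core) (wq := wq) (r := rq) hKb hKa1 shiftsFlat_nodup h𝕊 hq hω hcoef (lev := lev) (c₀ := c₀q)
    (Mq := Mq) (i₀ := (0 : Fin 2)) (σ := σq) (ρ := ρq) (Zx := Zx) (θn := θn) (θd := θd)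
    (Cs := fun bb j => Cs (tgt bb j)) (ell := ell) (cen := fun bb j => cen (tgt bb j)) (chw := fun bb j => chw (tgt bb j))
    hg hj (fun bb j hjb => hs bb j (by have := hjN bb; omega)) hsec hread (fun bb j _ _ z hz => hcoreL (tgt bb j) z hz) hbefore hafter hpos
    hc₀N hid hE hcover
  rw [shiftsFlat_toFinset, cast_mirrorTableQ_half, hqe] at htrap0 hland0
  refine stub_rung_quarter_of_checks hX₀ hKb hKa hr hρ hρ1 hθ₀ hθ₀θ hθ hc₀ hc₀c hσ hMmax hcore hdatum hCw hb hwp hwn hCb hγ0 hγ1 hZb hZf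
    hMZf checkB₁ checkB₂ hcoreTop hνKa hνhi hν₀ hν₁ hMν checkA₁ checkA₂ checkA₃ checkA₄ checkA₅ checkA₆ hinside ?_ ?_
  · intro s z S hz hs0 hsc hS0 hd hcb hct hbb hbt hMb
    exact htrap0 s z S hz hs0 hsc hS0 hd hcb hct (fun i u hu => (hbb i u hu).trans hEb) (fun i u hu => (hbt i u hu).trans hEt) hMb
  · intro z S hz hS0 hd hcb hct hbb hbt hMb
    obtain ⟨τ₁, a', z', h1, h2, h3, h4, h5, h6, h7, h8, h9⟩ :=
      hland0 z S hz hS0 hd hcb hct (fun i u hu => (hbb i u hu).trans hEb) (fun i u hu => (hbt i u hu).trans hEt) hMb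
    exact ⟨τ₁, a', z', h1, h2, h3, h4, h5, h6, h7, fun i v hv => h8 i v (hv.trans hEt),
      fun i => (h9 i).trans (mul_le_mul_of_nonneg_left hZx h3.le)⟩

end CertificateGlueOn

end Summit.NavierStokesRegularity.NavierStokesRegularity.Theorems

end
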